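import Literature.RingTheory.FormalGroups.NilpotentEvaluationPair
import HarnessLib

/-!
# Evaluation at nilpotent pairs commutes with substitution: `(φ(F))(x,y) = φ(F(x,y))`, `(G(a,b))(x,y) = G(a(x,y), b(x,y))`
# ([Bourbaki, Algebra II] Ch. IV §4 no. 3; P6d points currency, desk word (β) item (i))

Topic `Literature/RingTheory/FormalGroups`; namespace `Literature.RingTheory.FormalGroups`.  THEOREMS ONLY (no definition, no named fact,
no instance, no notation, no `sorry`).  Cell `hodgecm-mathlib`, P6 «MOD programme» ROW 4B — the two COMPOSITION LEMMAS the P6d dictionary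
needs to see that homomorphisms `φ : F → G` (★ `FormalGroupHom`) and the `[m]`-series respect the `F`-addition of nilpotent points:
evaluate `φ(F(X,Y)) = G(φ X, φ Y)` at a nilpotent pair `(x,y)` with `evalNilp₂_powerSeries_subst` on the left and
`evalNilp₂_subst_pair` on the right (`FormalGroupHom.evalNilp_evalNilp₂`).

## Contents

* `coeff_eq_zero_of_degree_lt_of_constantCoeff_eq_zero` — `F(0,0) = 0 ⇒ (F^d)_m = 0` whenever `|m| < d`.
* **`evalNilp₂_powerSeries_subst`**: `evalNilp₂ (φ.subst F) x y = evalNilp φ (evalNilp₂ F x y)` for `F(0,0) = 0`.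
* **`evalNilp₂_subst_pair`**: `evalNilp₂ (G.subst ![a, b]) x y = evalNilp₂ G (evalNilp₂ a x y) (evalNilp₂ b x y)` for `a(0,0) = b(0,0) = 0`.
* **`FormalGroupHom.evalNilp_evalNilp₂`**: `φ(F(x,y)) = G(φ(x), φ(y))` on nilpotent points (`evalNilp`, `evalNilp₂` currency).
-/

noncomputable section

namespace Literature.RingTheory.FormalGroups

open Finset

universe u v

variable {A : Type u} [CommRing A] {R : Type v} [CommRing R] [Algebra A R]

/-! ## §1 Vanishing of low coefficients of powers -/

/-- `F(0,0) = 0 ⇒` the coefficients of `F^d` in total degree `< d` vanish. [cite: BourbakiAlgebraII2003, Ch. IV §4 no. 2] -/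
theorem coeff_pow_eq_zero_of_degree_lt {σ : Type*} {F : MvPowerSeries σ A} (hF : MvPowerSeries.constantCoeff F = 0) {m : σ →₀ ℕ} {d : ℕ}
    (hmd : Finsupp.degree m < d) : MvPowerSeries.coeff m (F ^ d) = 0 :=
  MvPowerSeries.coeff_of_lt_order (lt_of_lt_of_le (by exact_mod_cast hmd) (MvPowerSeries.le_order_pow_of_constantCoeff_eq_zero d hF))

/-- `a(0,0) = b(0,0) = 0 ⇒` the coefficients of `a^{e₀} b^{e₁}` in total degree `< e₀ + e₁` vanish. [cite: BourbakiAlgebraII2003, Ch. IV §4 no. 2] -/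
theorem coeff_pow_mul_pow_eq_zero_of_degree_lt {σ : Type*} {a b : MvPowerSeries σ A} (ha : MvPowerSeries.constantCoeff a = 0)
    (hb : MvPowerSeries.constantCoeff b = 0) {m : σ →₀ ℕ} {e₀ e₁ : ℕ} (hm : Finsupp.degree m < e₀ + e₁) :
    MvPowerSeries.coeff m (a ^ e₀ * b ^ e₁) = 0 := by
  refine MvPowerSeries.coeff_of_lt_order (lt_of_lt_of_le ?_ MvPowerSeries.le_order_mul)
  have h1 : ((Finsupp.degree m : ℕ) : ℕ∞) < (e₀ : ℕ∞) + (e₁ : ℕ∞) := by exact_mod_cast hm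
  exact lt_of_lt_of_le h1 (add_le_add (MvPowerSeries.le_order_pow_of_constantCoeff_eq_zero e₀ ha)
    (MvPowerSeries.le_order_pow_of_constantCoeff_eq_zero e₁ hb))

/-- Total degree inside a box of `Fin 2 →₀ ℕ`: `d ≤ n ⇒ |d| ≤ n₀ + n₁`. [cite: BourbakiAlgebraII2003, Ch. IV §4 no. 1] -/
theorem degree_le_of_le {d n : Fin 2 →₀ ℕ} (h : d ≤ n) : Finsupp.degree d ≤ n 0 + n 1 := by
  rw [Finsupp.degree_eq_sum, Fin.sum_univ_two]
  rw [le_iff_fin_two] at h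
  omega

/-! ## §2 `(φ(F))(x,y) = φ(F(x,y))` -/

/-- **Evaluation commutes with univariate substitution into a two-variable series**: `evalNilp₂ (φ(F)) x y = evalNilp φ (evalNilp₂ F x y)`
for `F(0,0) = 0` and a nilpotent pair `(x, y)`. [cite: BourbakiAlgebraII2003, Ch. IV §4 no. 3] -/
theorem evalNilp₂_powerSeries_subst {F : MvPowerSeries (Fin 2) A} (hF : MvPowerSeries.constantCoeff F = 0) (φ : PowerSeries A) {x y : R}
    (hx : IsNilpotent x) (hy : IsNilpotent y) :
    evalNilp₂ (PowerSeries.subst F φ) x y = evalNilp φ (evalNilp₂ F x y) := by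
  classical
  obtain ⟨n, hxn, hyn⟩ := exists_box hx hy
  obtain ⟨K, hK⟩ := isNilpotent_evalNilp₂ hF x y
  have hFs : PowerSeries.HasSubst F := PowerSeries.HasSubst.of_constantCoeff_zero hF
  -- a common bound `L` for the `φ`-index: beyond `K` (nilpotency of `F(x,y)`) and beyond the box degree `n₀ + n₁`
  set L := K + (n 0 + n 1 + 1) with hL
  have hKL : evalNilp₂ F x y ^ L = 0 := by rw [hL, pow_add, hK, zero_mul]
  -- right-hand side
  rw [evalNilp_eq_sum φ hKL]
  simp_rw [← evalNilp₂_pow hx hy F]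
  -- left-hand side: coefficients of `φ(F)` in the box are finite sums over `d < L`
  have hcoeff : ∀ m ∈ Finset.Iic n, MvPowerSeries.coeff m (PowerSeries.subst F φ) =
      ∑ d ∈ range L, PowerSeries.coeff d φ * MvPowerSeries.coeff m (F ^ d) := by
    intro m hm
    rw [PowerSeries.coeff_subst hFs φ m, finsum_eq_sum_of_support_subset _ (s := range L)]
    · simp [smul_eq_mul]
    · intro d hd
      simp only [Function.mem_support, ne_eq, Finset.coe_range, Set.mem_Iio] at hd ⊢
      by_contra hdL
      apply hd
      rw [coeff_pow_eq_zero_of_degree_lt hF (lt_of_le_of_lt (degree_le_of_le (Finset.mem_Iic.mp hm)) (by omega)), smul_zero]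
  rw [evalNilp₂_eq_sum_Iic _ hxn hyn, Finset.sum_congr rfl fun m hm => by rw [hcoeff m hm]]
  simp_rw [map_sum, map_mul, Finset.sum_mul, evalNilp₂_eq_sum_Iic _ hxn hyn, Finset.mul_sum]
  rw [Finset.sum_comm]
  refine Finset.sum_congr rfl fun d _ => Finset.sum_congr rfl fun m _ => ?_
  ring

/-! ## §3 `(G(a,b))(x,y) = G(a(x,y), b(x,y))` -/

/-- The monomial `a^{e₀} b^{e₁}` of the substitution formula for a pair of two-variable series. [cite: BourbakiAlgebraII2003, Ch. IV §4 no. 3] -/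
theorem prod_pair_pow₂ (a b : MvPowerSeries (Fin 2) A) (e : Fin 2 →₀ ℕ) :
    (e.prod fun i k => ((![a, b] : Fin 2 → MvPowerSeries (Fin 2) A) i) ^ k) = a ^ (e 0) * b ^ (e 1) := by
  rw [Finsupp.prod_fintype _ _ (fun _ => pow_zero _)]
  simp [Fin.prod_univ_two]

/-- **Evaluation commutes with two-variable substitution**: `evalNilp₂ (G(a,b)) x y = evalNilp₂ G (a(x,y)) (b(x,y))` for
`a(0,0) = b(0,0) = 0` and a nilpotent pair `(x,y)`. [cite: BourbakiAlgebraII2003, Ch. IV §4 no. 3] -/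
theorem evalNilp₂_subst_pair (G : MvPowerSeries (Fin 2) A) {a b : MvPowerSeries (Fin 2) A} (ha : MvPowerSeries.constantCoeff a = 0)
    (hb : MvPowerSeries.constantCoeff b = 0) {x y : R} (hx : IsNilpotent x) (hy : IsNilpotent y) :
    evalNilp₂ (MvPowerSeries.subst ![a, b] G) x y = evalNilp₂ G (evalNilp₂ a x y) (evalNilp₂ b x y) := by
  classical
  obtain ⟨n, hxn, hyn⟩ := exists_box hx hy
  have hu : IsNilpotent (evalNilp₂ a x y) := isNilpotent_evalNilp₂ ha x y
  have hv : IsNilpotent (evalNilp₂ b x y) := isNilpotent_evalNilp₂ hb x y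
  obtain ⟨n', hun, hvn⟩ := exists_box hu hv
  have hab : MvPowerSeries.HasSubst ![a, b] :=
    MvPowerSeries.hasSubst_of_constantCoeff_zero fun i => by fin_cases i <;> simp [ha, hb]
  -- the common big box `N ≥ n'` with `N i ≥ n₀ + n₁ + 1`
  set D := n 0 + n 1 + 1 with hD
  set N : Fin 2 →₀ ℕ := n' + (Finsupp.single 0 D + Finsupp.single 1 D) with hN
  have hN0 : N 0 = n' 0 + D := by simp [hN]
  have hN1 : N 1 = n' 1 + D := by simp [hN]
  have hn'N : n' ≤ N := by rw [hN]; exact le_add_of_nonneg_right bot_le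
  -- right-hand side over the big box
  have huN : evalNilp₂ a x y ^ (N 0 + 1) = 0 := by
    rw [hN0, show n' 0 + D + 1 = (n' 0 + 1) + D by ring, pow_add, hun, zero_mul]
  have hvN : evalNilp₂ b x y ^ (N 1 + 1) = 0 := by
    rw [hN1, show n' 1 + D + 1 = (n' 1 + 1) + D by ring, pow_add, hvn, zero_mul]
  rw [evalNilp₂_eq_sum_Iic G huN hvN]
  simp_rw [← evalNilp₂_pow hx hy, ← evalNilp₂_mul]
  -- left-hand side: coefficients of `G(a,b)` in the box `n` are finite sums over `e ∈ Iic N`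
  have hcoeff : ∀ m ∈ Finset.Iic n, MvPowerSeries.coeff m (MvPowerSeries.subst ![a, b] G) =
      ∑ e ∈ Finset.Iic N, MvPowerSeries.coeff e G * MvPowerSeries.coeff m (a ^ (e 0) * b ^ (e 1)) := by
    intro m hm
    rw [MvPowerSeries.coeff_subst hab G m, finsum_eq_sum_of_support_subset _ (s := Finset.Iic N)]
    · exact Finset.sum_congr rfl fun e _ => by rw [prod_pair_pow₂, smul_eq_mul]
    · intro e he
      simp only [Function.mem_support, ne_eq, Finset.coe_Iic, Set.mem_Iic] at he ⊢
      by_contra heN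
      apply he
      rw [prod_pair_pow₂, coeff_pow_mul_pow_eq_zero_of_degree_lt ha hb
        (lt_of_le_of_lt (degree_le_of_le (Finset.mem_Iic.mp hm)) ?_), smul_zero]
      -- `e ≰ N` forces `e₀ + e₁ ≥ D > n₀ + n₁`
      rw [le_iff_fin_two, hN0, hN1, not_and_or, not_le, not_le] at heN
      omega
  rw [evalNilp₂_eq_sum_Iic _ hxn hyn, Finset.sum_congr rfl fun m hm => by rw [hcoeff m hm]]
  simp_rw [map_sum, map_mul, Finset.sum_mul, evalNilp₂_eq_sum_Iic _ hxn hyn, Finset.mul_sum]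
  rw [Finset.sum_comm]
  refine Finset.sum_congr rfl fun e _ => Finset.sum_congr rfl fun m _ => ?_
  ring

/-! ## §4 Homomorphisms respect `F`-addition of nilpotent points -/

/-- A univariate series substituted at the variable `X i` evaluates at the `i`-th coordinate: `(φ(X₀))(x,y) = φ(x)`.
[cite: BourbakiAlgebraII2003, Ch. IV §4 no. 3] -/
theorem evalNilp₂_powerSeries_subst_X₀ (φ : PowerSeries A) {x y : R} (hx : IsNilpotent x) (hy : IsNilpotent y) :
    evalNilp₂ (PowerSeries.subst (MvPowerSeries.X 0 : MvPowerSeries (Fin 2) A) φ) x y = evalNilp φ x := by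
  rw [evalNilp₂_powerSeries_subst (MvPowerSeries.constantCoeff_X 0) φ hx hy, evalNilp₂_X₀ hx hy]

/-- `(φ(X₁))(x,y) = φ(y)`. [cite: BourbakiAlgebraII2003, Ch. IV §4 no. 3] -/
theorem evalNilp₂_powerSeries_subst_X₁ (φ : PowerSeries A) {x y : R} (hx : IsNilpotent x) (hy : IsNilpotent y) :
    evalNilp₂ (PowerSeries.subst (MvPowerSeries.X 1 : MvPowerSeries (Fin 2) A) φ) x y = evalNilp φ y := by
  rw [evalNilp₂_powerSeries_subst (MvPowerSeries.constantCoeff_X 1) φ hx hy, evalNilp₂_X₁ hx hy]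

/-- **Homomorphisms of formal group laws respect the `F`-addition of nilpotent points: `φ(F(x,y)) = G(φ(x), φ(y))`.**
[cite: Hazewinkel1978, §1.2 Def. (1.2.1)] -/
theorem FormalGroupHom.evalNilp_evalNilp₂ {F G : FormalGroup A} (φ : FormalGroupHom F G) {x y : R} (hx : IsNilpotent x) (hy : IsNilpotent y) :
    evalNilp φ.toPowerSeries (evalNilp₂ F.toPowerSeries x y) =
      evalNilp₂ G.toPowerSeries (evalNilp φ.toPowerSeries x) (evalNilp φ.toPowerSeries y) := by
  rw [← evalNilp₂_powerSeries_subst F.zero_constantCoeff φ.toPowerSeries hx hy, φ.map_add,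
    evalNilp₂_subst_pair G.toPowerSeries (φ.constantCoeff_subst_eq_zero (MvPowerSeries.constantCoeff_X 0))
      (φ.constantCoeff_subst_eq_zero (MvPowerSeries.constantCoeff_X 1)) hx hy,
    evalNilp₂_powerSeries_subst_X₀ _ hx hy, evalNilp₂_powerSeries_subst_X₁ _ hx hy]

end Literature.RingTheory.FormalGroups
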